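import Summits.HubbardSuperconductivity.HubbardSuperconductivity.Theorems.WeakCouplingBCSKlCertFermiSeaPolygonSound
import Summits.HubbardSuperconductivity.HubbardSuperconductivity.Theorems.WeakCouplingBCSKlIsoDensityLevelMotion
import Summits.HubbardSuperconductivity.HubbardSuperconductivity.Theorems.KLProgrammeMuOfDopingWindowFillingD005Lower

/-!
# KL-MARGIN-SCAN reader hubbard-klscan-idea-4 (lens «cascade»), round 9 — ORDER-IDEAL STAIRCASE CERTIFICATES, part 1/5 (§1–§3: data, monotonicity, corner soundness)
# for the filling of the `t`–`t′` band, and the tube-edge facts of the iso-density lines as kernel theorems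
# (crux idea «monotone-sea-staircase» on `stmt-HubbardSuperconductivity-0158`)

THESIS (free-band geometry; nothing here is a statement about superconductivity). For `|t′| ≤ 1/2` the `t`–`t′` band
`ε_{t′}(k) = −2(cos k₀ + cos k₁) − 4t′ cos k₀ cos k₁ = squareDispersion 1 t′ k` is COORDINATEWISE INCREASING in `(|k₀|, |k₁|) ∈ [0,π]²`
(`bandR_cos_mono`: the band is affine and antitone in each cosine as soon as `−2 ≤ 4t′·c` for the other cosine `c ∈ [−1,1]`). Hence the
Fermi sea `{ε_{t′} < μ}` is, in the folded quarter zone, a LOWER SET (an order ideal of `[0,π]²`), and its area — the filling is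
`n[ε_{t′}](μ) = volume(sea)/π²` (`filling_eq_volume`) — is enclosed between an inscribed and a circumscribed STAIRCASE of boxes whose
validity is decided by ONE rational sign check per corner: an inner corner `(x, y)` needs `bandQ t′ (cosLoQ x) (cosLoQ y) < μ` (Taylor
minorant `cosLoQ = T₇ ≤ cos` of the tree's `FSPoly`, substituted antitonically), an outer corner needs `μ ≤ bandQ t′ (cosUpQ x) (cosUpQ y)`
(majorant `cosUpQ = T₈`) or is a FULL column `y = piUpQ`; both carry the guard `−2 ≤ 4t′·T(x)` licensing the substitution in the second
cosine (`icorner_sound`, `ocorner_sound`). Everything is exact rational arithmetic: `IStair.check` / `OStair.check` are Booleans settled by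
`decide +kernel`, and `IStair.le_filling` / `OStair.filling_lt` turn a checked certificate into `r ≤ n[ε_{t′}](μ)` / `n[ε_{t′}](μ) < r`
over `ℝ` (`π` enclosed by `FSPoly.piLoQ < π < piUpQ`). NO CONVEXITY is used — the certificates are sound in the `Γ`-side inflection band
`μ_c(t′) < μ < 4t′`, where the sea boundary has an inflection point and polygon certificates in the style of
`WeakCouplingBCSKlCertFermiSeaPolygonSound` are unsound (`KlCertTPrimeConvexity.gammaSide_inflection`, p677334). The gap of a `K`-corner
staircase is first order, `≈ 0.88/K` in filling units (Darboux: `U − L = Σ (M_k − m_k)Δx_k` for a monotone boundary; corners are placed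
`ℓ¹`-equispaced along the boundary curve).

CUSTOMERS (15 certificates, 4 994 corners, generated and exactly pre-verified by `r9/calc/emit_lean.py`, re-verified by the kernel in ≈ 2 min):
* §8 — the four HYPOTHESES of round 8 (`KlLevelMotion.line_d0125_zones_of_edges`, `branches_of_edges`, `line_d035_all_Gamma_of_edge`,
  p686003) are now theorems: `vhLevel_d0125_Medge : 1/40 ≤ d̃(⅛; −9/50)`, `vhLevel_d0125_Gedge : d̃(⅛; −3/25) ≤ −1/40`,
  `vhLevel_m03_Gedge : d̃(δ; −3/10) ≤ −1/40` for `δ ∈ [3/10, 1)`; so `line_d0125_zones`, `line_d0125_halflines`, `line_d030_all_Gamma`,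
  `line_d035_all_Gamma` hold UNCONDITIONALLY: on the funded line `δ = ⅛` every VH-excluded `t′` lies in `(−0.18, −0.12)`, every
  `t′ ≤ −0.18` is `M`-side admissible and every `t′ ≥ −0.12` is `Γ`-side admissible (`d̃ = μ(δ;t′) − 4t′ = KlLevelMotion.vhLevel t′ δ`).
* §9 — kernel brackets of the van Hove dopings `δ_VH(t′) = klVanHoveDopingTP t′`: `δ_VH(−0.1) ∈ (0.0769, 0.087]`,
  `δ_VH(−0.2) ∈ (0.1651, 0.175]`, `δ_VH(−0.3) ∈ (0.2689, 0.2784]` (floats `0.08198 / 0.17001 / 0.27367`; margin-1 g14's float intervals lie inside).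
* §10 — the SIDE / ADMISSIBILITY WORDS of SCAN-TABLE v0.2: 27 of the 28 grid cells `δ ∈ {0.05, …, 0.35} × t′ ∈ {0, −0.1, −0.2, −0.3}` are
  certified — `column_0_cells` (from the tree's `muWinD005_filling_ge`, no new certificate), `column_m01_cells`, `column_m02_cells`,
  `column_m03_cells` (ONE tube-edge certificate per column and side, propagated along the iso-density lines by round 8's
  `not_excluded_of_Gedge` / `not_excluded_of_Medge`, so each is in fact a statement about a quadrant of the `(δ, t′)` plane), and the
  excluded word `cell_d010_m01_excluded : klVHExcludedTP (−1/10) (1/10)`; the 28th word, «`(0.15, −0.2)` VH-excluded» (float `d̃ = +0.0245`,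
  `0.0005` inside the tube wall), would need ≈ `2 × 2 500` corners and is left open.

CASCADE FINDING (where the chain of scales breaks, in numbers). A KL margin certified on a `μ`-box `[μ_lo, μ_hi]` at `t′ ≠ 0` (ENGINE-J,
job j320108: cell `(⅛, −0.3)`, box width `7.6·10⁻⁶`) is keyed to the doping `δ` IN THE KERNEL iff `n(μ_lo) < 1 − δ ≤ n(μ_hi)` is certified
(`le_muOfDoping_of_filling_lt`, `muOfDoping_le_of_le_filling`), i.e. iff the filling is enclosed to better than `dos · width/2 ≈ 1.8·10⁻⁶` —
`K ≈ 5·10⁵` corners per side with a first-order staircase: out of reach. A box of half-width `h` needs `K ≈ 1.83/h` corners per side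
(`dos ≈ 0.48` at `(⅛, −0.3)`): `h = 10⁻³ ⇒ K ≈ 1 800` (≈ 40 s kernel), `h = 10⁻² ⇒ K ≈ 180`. Recommendation to the margin engine: certify
`t′ ≠ 0` margins on `μ`-boxes of half-width `≥ 10⁻³` (box mode) rather than on bisection cells if the `δ`-key is to be a theorem; the
side / admissibility words need only `1/40`-scale information and are all in reach (this file).

HONEST FRAMING. Free-band filling geometry of `squareDispersion 1 t′` only. Floats quoted in docstrings are floats. Nothing here asserts
a KL margin at `t′ ≠ 0`, `K₃`, the window or superconductivity; a Kohn–Luttinger `O(U²)` channel statement is not ODLRO; nothing proves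
superconductivity in the Hubbard model; no `t′ ≠ 0` statement chains to the summit Statement (which hard-wires `squareDispersion 1 0`).

PRIOR ART IN THE TREE. `t′ = 0` uniform-row staircases for the torus level counts: `WeakCouplingBCSWcbcsBcsConstructionFreeLevelCountsRows` /
`…FreeLevelCountsWindow` (`stairs_le_volume_real_sublevelCell`, `decide +kernel` tables; crux `WcbcsBcsConstruction`). New here: general
`|t′| ≤ 1/2` via the cosine-monotonicity lever, non-uniform (`ℓ¹`-equispaced) corners with FULL columns, the Taylor-guarded
two-evaluation corner rule, and the doping / `vhLevel` corollaries feeding `KlLevelMotion`.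

References: Šimkovic–Liu–Deng–Kozik, Phys. Rev. B 94 (2016) 085106 = arXiv:1512.04271, §2.3 (the Van Hove line `μ = 4t′`; `|t′| = 1/2`
as the regime boundary beyond which the «line of nesting» appears); Raghu–Kivelson–Scalapino, Phys. Rev. B 81 (2010) 224505 =
arXiv:1002.0591, §II (4), §III; Hlubina, Phys. Rev. B 59 (1999) 9600; Hlubina–Sorella–Guinea, Phys. Rev. Lett. 78 (1997) 1343; Abbott,
Understanding Analysis (Springer 2015) §7.2, pp. 196–197 (Darboux enclosure `U(f,P) − L(f,P) = Σ (M_k − m_k)Δx_k`; increasing ⇒ integrable).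
Landing recipe (for the prover of record): split at §7 into `…KlStairCore` (§1–§6, ≈ 10 s) and `…KlStairCerts` (§7–§10). 0 kit · 0 sorry.
-/

noncomputable section

set_option linter.dupNamespace false

namespace Summit.HubbardSuperconductivity.HubbardSuperconductivity.Theorems.KlStair

open Real Set MeasureTheory Literature.MathematicalPhysics.QuantumLattice
open Summit.HubbardSuperconductivity.HubbardSuperconductivity.Theorems
open Summit.HubbardSuperconductivity.HubbardSuperconductivity.Theorems.FSPoly (cosLoQ cosUpQ piLoQ cosLoQ_le_cos cos_le_cosUpQ)
open Summit.HubbardSuperconductivity.HubbardSuperconductivity.Theorems.KlLevelMotion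

/-! ### §1  Computable data over `ℚ`: the band as a bilinear form of the two cosines, corner checks, the two formats -/

/-- A rational upper bound of `π` (`π < 3.141593`, Mathlib `Real.pi_lt_d6`); also the «FULL column» marker of outer corners. [folklore] -/
def piUpQ : ℚ := 3141593 / 1000000

/-- The `t`–`t′` band as a bilinear form of `a = cos k₀`, `b = cos k₁`: `E_{t′}(a, b) = −2(a + b) − 4t′ab` over `ℚ`. [folklore] -/
def bandQ (tp a b : ℚ) : ℚ := -2 * (a + b) - 4 * tp * a * b

/-- INNER corner test at `(x, y)` (closed first quadrant): `0 < y`, `x, y ≤ 3.141592`, the guard `−2 ≤ 4t′·T₇(x)`, and the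
certified inequality `ε_{t′}(x, y) ≤ E_{t′}(T₇(x), T₇(y)) < μ` (only the degree-14 Taylor MINORANT `T₇ = cosLoQ` is evaluated). [folklore] -/
def icornerAux (tp mu a b : ℚ) (c : ℚ × ℚ) : Bool :=
  decide (0 < c.2) && decide (c.1 ≤ piLoQ) && decide (c.2 ≤ piLoQ) && decide (-2 ≤ 4 * tp * a) && decide (bandQ tp a b < mu)

/-- INNER corner test (see `icornerAux`). [folklore] -/
def icornerOK (tp mu : ℚ) (c : ℚ × ℚ) : Bool := icornerAux tp mu (cosLoQ c.1) (cosLoQ c.2) c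

/-- OUTER corner test at `(u, v)`: `0 ≤ u`, `0 ≤ v`, and either `v` is a FULL column (`v ≥ 3.141593 > π`) or the guard
`−2 ≤ 4t′·T₈(u)` and the certified inequality `μ ≤ E_{t′}(T₈(u), T₈(v)) ≤ ε_{t′}(u, v)` (degree-16 Taylor MAJORANT `T₈ = cosUpQ`). [folklore] -/
def ocornerAux (tp mu a b : ℚ) (c : ℚ × ℚ) : Bool :=
  decide (0 ≤ c.1) && decide (0 ≤ c.2) && (decide (piUpQ ≤ c.2) || (decide (-2 ≤ 4 * tp * a) && decide (mu ≤ bandQ tp a b)))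

/-- OUTER corner test (see `ocornerAux`). [folklore] -/
def ocornerOK (tp mu : ℚ) (c : ℚ × ℚ) : Bool := ocornerAux tp mu (cosUpQ c.1) (cosUpQ c.2) c

/-- INNER chain: abscissae non-decreasing from `xp`, every corner certified (structural recursion). [folklore] -/
def ichain (tp mu : ℚ) : ℚ → List (ℚ × ℚ) → Bool
  | _, [] => true
  | xp, c :: rest => decide (xp ≤ c.1) && icornerOK tp mu c && ichain tp mu c.1 rest

/-- Quarter-area of the INNER staircase from abscissa `xp` on: `Σ_j (x_j − x_{j−1}) y_j`. [folklore] -/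
def iarea : ℚ → List (ℚ × ℚ) → ℚ
  | _, [] => 0
  | xp, c :: rest => (c.1 - xp) * c.2 + iarea c.1 rest

/-- OUTER chain: current corner certified, abscissae non-decreasing, the last column ends at `3.141593`. [folklore] -/
def ochain (tp mu : ℚ) : ℚ × ℚ → List (ℚ × ℚ) → Bool
  | c, [] => ocornerOK tp mu c && decide (c.1 ≤ piUpQ)
  | c, c' :: rest => ocornerOK tp mu c && decide (c.1 ≤ c'.1) && ochain tp mu c' rest

/-- Quarter-area of the OUTER staircase from corner `c` on: `Σ_j (u_{j+1} − u_j) v_j`, `u_K := 3.141593`. [folklore] -/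
def oarea : ℚ × ℚ → List (ℚ × ℚ) → ℚ
  | c, [] => (piUpQ - c.1) * c.2
  | c, c' :: rest => (c'.1 - c.1) * c.2 + oarea c' rest

/-- An INNER (inscribed) order-ideal staircase certificate for the Fermi sea of `ε_{t′}` at energy `μ`: corners `(x_j, y_j)`,
`0 ≤ x_1 ≤ x_2 ≤ …`, each certified INSIDE the sea; the sea being a lower set of `[0, π]²` (for `|t′| ≤ 1/2`) it contains the
symmetric boxes `{x_{j−1} ≤ |k₀| < x_j, |k₁| < y_j}`. [folklore] -/
structure IStair where
  /-- next-nearest-neighbour hopping `t′` (`|t′| ≤ 1/2`) -/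
  tp : ℚ
  /-- energy `μ` -/
  mu : ℚ
  /-- corners `(x_j, y_j)` from left to right -/
  cs : List (ℚ × ℚ)

/-- The INNER checker: `|t′| ≤ 1/2` and the corner chain from abscissa `0`. [folklore] -/
def IStair.check (C : IStair) : Bool :=
  decide (-(1 / 2 : ℚ) ≤ C.tp) && decide (C.tp ≤ 1 / 2) && ichain C.tp C.mu 0 C.cs

/-- Quarter-area of an INNER certificate. [folklore] -/
def IStair.area (C : IStair) : ℚ := iarea 0 C.cs

/-- An OUTER (circumscribed) order-ideal staircase certificate: corners `(u_j, v_j)`, `0 = u_0 ≤ u_1 ≤ …`, each certified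
OUTSIDE the closed sea (or a FULL column); the sea then lies in the union of the boxes `{u_j ≤ |k₀| < u_{j+1}, |k₁| < v_j}`. [folklore] -/
structure OStair where
  /-- next-nearest-neighbour hopping `t′` (`|t′| ≤ 1/2`) -/
  tp : ℚ
  /-- energy `μ` -/
  mu : ℚ
  /-- corners `(u_j, v_j)` from left to right, `u_0 = 0` -/
  cs : List (ℚ × ℚ)

/-- The OUTER checker: `|t′| ≤ 1/2`, first abscissa `0`, and the corner chain. [folklore] -/
def OStair.check (C : OStair) : Bool :=
  decide (-(1 / 2 : ℚ) ≤ C.tp) && decide (C.tp ≤ 1 / 2) &&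
    match C.cs with
    | [] => false
    | c :: rest => decide (c.1 = 0) && ochain C.tp C.mu c rest

/-- Quarter-area of an OUTER certificate. [folklore] -/
def OStair.area (C : OStair) : ℚ :=
  match C.cs with
  | [] => 0
  | c :: rest => oarea c rest

/-- Corner tables are stored as natural numbers in units of `10⁻⁶` (cheap to elaborate); this rescales them. [folklore] -/
def ofMicro (l : List (ℕ × ℕ)) : List (ℚ × ℚ) :=
  l.map fun p => ((p.1 : ℚ) / 1000000, (p.2 : ℚ) / 1000000)

/-! ### §2  The band is coordinatewise increasing on `[0, π]²` for `|t′| ≤ 1/2`; rational corner enclosures -/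

/-- The band as a bilinear form over `ℝ`. [folklore] -/
def bandR (tp a b : ℝ) : ℝ := -2 * (a + b) - 4 * tp * a * b

/-- The rational band agrees with the real band under the cast `ℚ → ℝ`. [folklore] -/
theorem cast_bandQ (tp a b : ℚ) : ((bandQ tp a b : ℚ) : ℝ) = bandR tp a b := by
  simp only [bandQ, bandR]; push_cast; ring

/-- `ε_{1,t′}(k) = bandR t′ (cos k₀) (cos k₁)`. [folklore] -/
theorem squareDispersion_eq_bandR (tp : ℝ) (k : Momentum) :
    squareDispersion 1 tp k = bandR tp (cos (k 0)) (cos (k 1)) := by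
  simp only [squareDispersion, bandR]; ring

/-- `E_{t′}(·, b)` is antitone for `|b| ≤ 1`, `|t′| ≤ 1/2` (coefficient `−2 − 4t′b ≤ 0`). [folklore] -/
theorem bandR_anti_left {tp a a' b : ℝ} (htp : |tp| ≤ 1 / 2) (hb : |b| ≤ 1) (h : a ≤ a') :
    bandR tp a' b ≤ bandR tp a b := by
  have h1 : |tp * b| ≤ 1 / 2 := by
    rw [abs_mul]
    calc |tp| * |b| ≤ 1 / 2 * 1 := mul_le_mul htp hb (abs_nonneg _) (by norm_num)
      _ = 1 / 2 := by norm_num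
  have h2 : 0 ≤ 2 + 4 * (tp * b) := by linarith [neg_abs_le (tp * b)]
  have e : bandR tp a b - bandR tp a' b = (a' - a) * (2 + 4 * (tp * b)) := by unfold bandR; ring
  exact sub_nonneg.1 (by rw [e]; exact mul_nonneg (sub_nonneg.2 h) h2)

/-- `E_{t′}(a, ·)` is antitone under the guard `−2 ≤ 4t′a`. [folklore] -/
theorem bandR_anti_right {tp a b b' : ℝ} (hg : -2 ≤ 4 * tp * a) (h : b ≤ b') :
    bandR tp a b' ≤ bandR tp a b := by
  have e : bandR tp a b - bandR tp a b' = (b' - b) * (2 + 4 * tp * a) := by unfold bandR; ring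
  exact sub_nonneg.1 (by rw [e]; exact mul_nonneg (sub_nonneg.2 h) (by linarith))

/-- **The lever.**  For `|t′| ≤ 1/2` the band `ε_{t′}(x, y) = −2(cos x + cos y) − 4t′ cos x cos y` is coordinatewise
INCREASING on `[0, π]²`: `ε(x′, y′) − ε(x, y) = (cos x − cos x′)(2 + 4t′cos y′) + (cos y − cos y′)(2 + 4t′cos x) ≥ 0`.
Hence the Fermi sea `{ε_{t′} < μ} ∩ [0, π]²` is a LOWER SET (order ideal) — no convexity is involved. [folklore] -/
theorem bandR_cos_mono {tp : ℝ} (htp : |tp| ≤ 1 / 2) {x x' y y' : ℝ} (hx0 : 0 ≤ x) (hxx' : x ≤ x') (hx' : x' ≤ π)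
    (hy0 : 0 ≤ y) (hyy' : y ≤ y') (hy' : y' ≤ π) :
    bandR tp (cos x) (cos y) ≤ bandR tp (cos x') (cos y') := by
  have hcx : cos x' ≤ cos x := Real.cos_le_cos_of_nonneg_of_le_pi hx0 hx' hxx'
  have hcy : cos y' ≤ cos y := Real.cos_le_cos_of_nonneg_of_le_pi hy0 hy' hyy'
  have q1 : |tp * cos y'| ≤ 1 / 2 := by
    rw [abs_mul]
    calc |tp| * |cos y'| ≤ 1 / 2 * 1 := mul_le_mul htp (abs_cos_le_one _) (abs_nonneg _) (by norm_num)
      _ = 1 / 2 := by norm_num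
  have q2 : |tp * cos x| ≤ 1 / 2 := by
    rw [abs_mul]
    calc |tp| * |cos x| ≤ 1 / 2 * 1 := mul_le_mul htp (abs_cos_le_one _) (abs_nonneg _) (by norm_num)
      _ = 1 / 2 := by norm_num
  have p1 : 0 ≤ 2 + 4 * (tp * cos y') := by linarith [neg_abs_le (tp * cos y')]
  have p2 : 0 ≤ 2 + 4 * (tp * cos x) := by linarith [neg_abs_le (tp * cos x)]
  have e : bandR tp (cos x') (cos y') - bandR tp (cos x) (cos y) =
      (cos x - cos x') * (2 + 4 * (tp * cos y')) + (cos y - cos y') * (2 + 4 * (tp * cos x)) := by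
    unfold bandR; ring
  exact sub_nonneg.1 (by rw [e]; exact add_nonneg (mul_nonneg (sub_nonneg.2 hcx) p1) (mul_nonneg (sub_nonneg.2 hcy) p2))

/-- `π` is below its rational upper enclosure. [folklore] -/
theorem pi_lt_piUpQ : π < ((piUpQ : ℚ) : ℝ) := by
  rw [piUpQ]; push_cast; linarith [Real.pi_lt_d6]

/-- Soundness of the INNER corner test: the corner lies in `(−π, π)`-range and `ε_{t′}(x, y) < μ`. [folklore] -/
theorem icorner_sound {tp mu : ℚ} (htp : |(tp : ℝ)| ≤ 1 / 2) {c : ℚ × ℚ} (h : icornerOK tp mu c = true) :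
    (0 : ℝ) < c.2 ∧ ((c.1 : ℚ) : ℝ) < π ∧ ((c.2 : ℚ) : ℝ) < π ∧
      bandR tp (cos (c.1 : ℝ)) (cos (c.2 : ℝ)) < (mu : ℝ) := by
  simp only [icornerOK, icornerAux, Bool.and_eq_true, decide_eq_true_eq] at h
  obtain ⟨⟨⟨⟨h0, h1⟩, h2⟩, hg⟩, hb⟩ := h
  have h0' : (0 : ℝ) < c.2 := by exact_mod_cast h0
  have h1' : ((c.1 : ℚ) : ℝ) ≤ ((piLoQ : ℚ) : ℝ) := by exact_mod_cast h1
  have h2' : ((c.2 : ℚ) : ℝ) ≤ ((piLoQ : ℚ) : ℝ) := by exact_mod_cast h2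
  have hg' : (-2 : ℝ) ≤ 4 * (tp : ℝ) * ((cosLoQ c.1 : ℚ) : ℝ) := by exact_mod_cast hg
  have hb' : ((bandQ tp (cosLoQ c.1) (cosLoQ c.2) : ℚ) : ℝ) < (mu : ℝ) := by exact_mod_cast hb
  rw [cast_bandQ] at hb'
  have hpiQ : ((piLoQ : ℚ) : ℝ) < π := by rw [FSPoly.piLoQ]; push_cast; linarith [Real.pi_gt_d6]
  refine ⟨h0', lt_of_le_of_lt h1' hpiQ, lt_of_le_of_lt h2' hpiQ, lt_of_le_of_lt ?_ hb'⟩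
  calc bandR tp (cos (c.1 : ℝ)) (cos (c.2 : ℝ))
      ≤ bandR tp ((cosLoQ c.1 : ℚ) : ℝ) (cos (c.2 : ℝ)) := bandR_anti_left htp (abs_cos_le_one _) (cosLoQ_le_cos c.1)
    _ ≤ bandR tp ((cosLoQ c.1 : ℚ) : ℝ) ((cosLoQ c.2 : ℚ) : ℝ) := bandR_anti_right hg' (cosLoQ_le_cos c.2)

/-- Soundness of the OUTER corner test: `0 ≤ u, v` and either `π < v` or `μ ≤ ε_{t′}(u, v)`. [folklore] -/
theorem ocorner_sound {tp mu : ℚ} (htp : |(tp : ℝ)| ≤ 1 / 2) {c : ℚ × ℚ} (h : ocornerOK tp mu c = true) :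
    (0 : ℝ) ≤ c.1 ∧ (0 : ℝ) ≤ c.2 ∧ (π < ((c.2 : ℚ) : ℝ) ∨ (mu : ℝ) ≤ bandR tp (cos (c.1 : ℝ)) (cos (c.2 : ℝ))) := by
  simp only [ocornerOK, ocornerAux, Bool.and_eq_true, Bool.or_eq_true, decide_eq_true_eq] at h
  obtain ⟨⟨h0, h1⟩, h2⟩ := h
  refine ⟨by exact_mod_cast h0, by exact_mod_cast h1, ?_⟩
  rcases h2 with hfull | ⟨hg, hb⟩
  · left
    have : ((piUpQ : ℚ) : ℝ) ≤ ((c.2 : ℚ) : ℝ) := by exact_mod_cast hfull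
    exact lt_of_lt_of_le pi_lt_piUpQ this
  · right
    have hg' : (-2 : ℝ) ≤ 4 * (tp : ℝ) * ((cosUpQ c.1 : ℚ) : ℝ) := by exact_mod_cast hg
    have hb' : (mu : ℝ) ≤ ((bandQ tp (cosUpQ c.1) (cosUpQ c.2) : ℚ) : ℝ) := by exact_mod_cast hb
    rw [cast_bandQ] at hb'
    refine hb'.trans ?_
    calc bandR tp ((cosUpQ c.1 : ℚ) : ℝ) ((cosUpQ c.2 : ℚ) : ℝ)
        ≤ bandR tp ((cosUpQ c.1 : ℚ) : ℝ) (cos (c.2 : ℝ)) := bandR_anti_right hg' (cos_le_cosUpQ c.2)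
      _ ≤ bandR tp (cos (c.1 : ℝ)) (cos (c.2 : ℝ)) := bandR_anti_left htp (abs_cos_le_one _) (cos_le_cosUpQ c.1)

/-! ### §3  The Fermi sea of `ε_{t′}` in coordinates; the filling as a volume; symmetric boxes -/

/-- The Fermi sea `{ε_{t′} < μ} ∩ BZ` read through `k ↦ (k₀, k₁)`. [folklore] -/
def seaCoord (tp μ : ℝ) : Set (ℝ × ℝ) :=
  {q | q.1 ∈ Ico (-π) π} ∩ ({q | q.2 ∈ Ico (-π) π} ∩ {q | bandR tp (cos q.1) (cos q.2) < μ})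

/-- The coordinate Fermi sea pulls back to the Fermi sea `{ε_{1,t′} < μ} ∩ BZ` in momentum space. [folklore] -/
theorem preimage_seaCoord (tp μ : ℝ) :
    (fun k : Momentum => ((k 0, k 1) : ℝ × ℝ)) ⁻¹' seaCoord tp μ =
      {p : Momentum | squareDispersion 1 tp p < μ} ∩ brillouinZone := by
  ext p
  simp only [seaCoord, mem_preimage, mem_inter_iff, mem_setOf_eq, brillouinZone, Fin.forall_fin_two,
    squareDispersion_eq_bandR]
  tauto

/-- The coordinate Fermi sea is measurable. [folklore] -/
theorem measurableSet_seaCoord (tp μ : ℝ) : MeasurableSet (seaCoord tp μ) := by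
  refine (measurable_fst measurableSet_Ico).inter ((measurable_snd measurableSet_Ico).inter ?_)
  exact measurableSet_lt (by unfold bandR; fun_prop) measurable_const

/-- The Fermi sea's volume equals the coordinate sea's volume (product-coordinate transport). [folklore] -/
theorem volume_sea_eq (tp μ : ℝ) :
    volume ({p : Momentum | squareDispersion 1 tp p < μ} ∩ brillouinZone) = volume (seaCoord tp μ) := by
  rw [← preimage_seaCoord, measurePreserving_momentum_prod.measure_preimage (measurableSet_seaCoord tp μ).nullMeasurableSet]

/-- The Fermi sea has finite volume (it sits in the Brillouin zone). [folklore] -/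
theorem volume_sea_lt_top (tp μ : ℝ) : volume ({p : Momentum | squareDispersion 1 tp p < μ} ∩ brillouinZone) < ⊤ :=
  lt_of_le_of_lt (measure_mono inter_subset_right) volume_brillouinZone_lt_top

/-- The filling of the `t`–`t′` band as a volume: `n[ε_{t′}](μ) = 2 vol({ε_{t′} < μ} ∩ BZ) / (2π)²`. [folklore] -/
theorem filling_eq_volume (tp μ : ℝ) :
    KohnLuttinger.filling (squareDispersion 1 tp) μ =
      2 * (volume ({p : Momentum | squareDispersion 1 tp p < μ} ∩ brillouinZone)).toReal / (2 * π) ^ 2 := by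
  have hS : MeasurableSet {p : Momentum | squareDispersion 1 tp p < μ} :=
    measurableSet_lt (measurable_squareDispersion 1 tp) measurable_const
  have hf : fermiOccupation (squareDispersion 1 tp) μ =
      Set.indicator {p : Momentum | squareDispersion 1 tp p < μ} (fun _ => (1 : ℝ)) := by
    funext p
    simp only [fermiOccupation, Set.indicator, Set.mem_setOf_eq]
  rw [KohnLuttinger.filling, hf, integral_indicator_const (1 : ℝ) hS, measureReal_restrict_apply hS, measureReal_def,
    smul_eq_mul, mul_one]

/-- The symmetric box `{a ≤ |q₀| < b} × {|q₁| < y}` (as a product of a difference of intervals with an interval). [folklore] -/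
def absBox (a b y : ℝ) : Set (ℝ × ℝ) := (Ioo (-b) b \ Ioo (-a) a) ×ˢ Ioo (-y) y

/-- Membership in `absBox a b y`: `a ≤ |q₁| < b` and `|q₂| < y`. [folklore] -/
theorem mem_absBox {a b y : ℝ} {q : ℝ × ℝ} : q ∈ absBox a b y ↔ a ≤ |q.1| ∧ |q.1| < b ∧ |q.2| < y := by
  rw [absBox, mem_prod, mem_sdiff, mem_Ioo, mem_Ioo, mem_Ioo, ← abs_lt, ← abs_lt, ← abs_lt, not_lt]
  tauto

/-- `absBox a b y` is measurable. [folklore] -/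
theorem measurableSet_absBox (a b y : ℝ) : MeasurableSet (absBox a b y) :=
  (measurableSet_Ioo.diff measurableSet_Ioo).prod measurableSet_Ioo

/-- `volume (absBox a b y) = 4·(b − a)·y` for `0 ≤ a ≤ b`. [folklore] -/
theorem volume_absBox {a b y : ℝ} (ha : 0 ≤ a) (hab : a ≤ b) :
    volume (absBox a b y) = ENNReal.ofReal (4 * ((b - a) * y)) := by
  rw [absBox, show (volume : Measure (ℝ × ℝ)) = (volume : Measure ℝ).prod volume from rfl, Measure.prod_prod,
    measure_sdiff (Ioo_subset_Ioo (by linarith) (by linarith)) measurableSet_Ioo.nullMeasurableSet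
      (by rw [Real.volume_Ioo]; exact ENNReal.ofReal_ne_top),
    Real.volume_Ioo, Real.volume_Ioo, Real.volume_Ioo, ← ENNReal.ofReal_sub _ (by linarith : (0 : ℝ) ≤ a - -a),
    ← ENNReal.ofReal_mul (by linarith)]
  congr 1; ring

/-- Points of the coordinate sea have `|q₀| ≤ π`, `|q₁| ≤ π`. [folklore] -/
theorem abs_le_pi_of_mem_seaCoord {tp μ : ℝ} {q : ℝ × ℝ} (hq : q ∈ seaCoord tp μ) : |q.1| ≤ π ∧ |q.2| ≤ π :=
  ⟨abs_le.2 ⟨hq.1.1, hq.1.2.le⟩, abs_le.2 ⟨hq.2.1.1, hq.2.1.2.le⟩⟩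


end Summit.HubbardSuperconductivity.HubbardSuperconductivity.Theorems.KlStair
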